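import Summits.QuantumFields.YangMills.Theorems.CurvatureAmnesia.Negative.Unbundled
import Summits.QuantumFields.YangMills.Theorems.CurvatureAmnesia.Negative.SigmaFiveRotation
import Literature.MathematicalPhysics.QuantumLattice.GaugeGroupsProofs

/-!
# `CurvatureAmnesia` — negative side III: the model-blind form is FALSE modulo `H`

Standing disprover of crux `stmt-QuantumFields-16192`, cycle 1, file 3/3.

`curvatureAmnesiaModelBlind_false_of` (clauses of `H` explicit) / `curvatureAmnesiaModelBlind_false_of_exists` (bundled,
character-identical to the Literature named fact `IsotropicOSFamilyExists`): `H → ¬ CurvatureAmnesiaModelBlind`; witness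
`G = SU(2)`, the fundamental representation, the weak-coupling scheme `β_k = k`, and the label-blind family
`blind S = S + J'` where `S` is the isotropic family of `H` and `J'` the degree-4 junk functional `J` of
`NPointIsotropy.Negative`. Since `J` vanishes on every time-separated configuration, EVERY OS clause (E0, E0h,
E0', E2, E3, E4), both translations and signed permutations on `⁰𝒮`, the continuum gap and the non-triviality
of the truncated two-point function of `S + J'` are those of `S` (`blind_*`), while
`(S + J')₄ (R·F₀) − (S + J')₄ (F₀) = J (R·F₀) − J F₀ = −J F₀ ≠ 0` for the Σ5 rotation `R` (`not_sigmaFive_blind`).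

MORAL (briefing for provers). The Wilson tie is load-bearing for every proof of the crux: weak coupling,
non-triviality, both OS gaps, reflection positivity and the sixteen signed-permutation symmetries together do
not force Σ5-blindness of `𝔖₄` — exactly as for the sibling cruxes `CurvatureBoostCovariance` /
`NPointIsotropy`, whose junk is reused here; the only new ingredient the crux adds over them (non-triviality of
the two-point function) is absorbed by adding an honest isotropic family, which the junk does not disturb.
-/

noncomputable section

-- Mathlib's `SimplexCategory` instance `Fintype (Fin (x.len + 1))` matches `Fintype (Fin 4)` and makes concrete
-- `Fin 4` instance paths diverge between elaborations (tree-known workaround, cf. `NPointIsotropy.Negative`).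
attribute [-instance] SimplexCategory.instFintypeToTypeOrderHomFinHAddNatLenOfNat

namespace Summit.QuantumFields.YangMills.Theorems.CurvatureAmnesia.Negative

open scoped BigOperators SchwartzMap ComplexConjugate InnerProductSpace
open MeasureTheory Filter Topology
open Literature.MathematicalPhysics.QuantumLattice Literature.MathematicalPhysics.AQFT
  Literature.MathematicalPhysics.QuantumFieldTheory
open Summit.QuantumFields.YangMills.Theorems.NPointIsotropy.Negative

/-! ## §4 The label-blind family `S + J'` -/

/-- The junk functional as a one-field family with no degree-`0` part: `J` in degree `4`, else `0`. -/
def junk' : SchwingerFamily E4 := fun n => if n = 0 then 0 else junk n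

/-- In positive degree `J'` is the junk family. -/
theorem junk'_of_ne_zero {n : ℕ} (hn : n ≠ 0) : junk' n = junk n := if_neg hn

/-- `J'` has no degree-`0` part. -/
theorem junk'_zero : junk' 0 = 0 := if_pos rfl

/-- Degree four of `J'` is `J`. -/
theorem junk'_four : junk' 4 = J := junk'_of_ne_zero (by norm_num)

/-- `junk'` kills time-separated functions. -/
theorem junk'_timeSep {n : ℕ} {F : SchwartzMap (Fin n → E4) ℂ} (hF : TimeSep F) : junk' n F = 0 := by
  rcases Nat.eq_zero_or_pos n with rfl | hn
  · rw [junk'_zero]; rfl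
  · rw [junk'_of_ne_zero hn.ne']; exact junk_timeSep_eq_zero hn.ne' hF

/-- `junk'` kills OS adjoints of time-separated functions. -/
theorem junk'_osAdjoint_timeSep {n : ℕ} {F : SchwartzMap (Fin n → E4) ℂ} (hF : TimeSep F) :
    junk' n (osAdjoint F) = 0 := by
  rcases Nat.eq_zero_or_pos n with rfl | hn
  · rw [junk'_zero]; rfl
  · rw [junk'_of_ne_zero hn.ne']; exact junk_osAdjoint_timeSep_eq_zero hn.ne' hF

/-- `junk'` kills `θF* ⊗ G` for time-separated `F, G`. -/
theorem junk'_append {n m : ℕ} {F : SchwartzMap (Fin n → E4) ℂ} {G : SchwartzMap (Fin m → E4) ℂ}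
    (hF : TimeSep F) (hG : TimeSep G) {H : SchwartzMap (Fin (n + m) → E4) ℂ}
    (hH : IsAppendTensorOf H (osAdjoint F) G) : junk' (n + m) H = 0 := by
  rcases Nat.eq_zero_or_pos (n + m) with hnm | hnm
  · rw [junk', if_pos hnm]; rfl
  · rw [junk'_of_ne_zero hnm.ne']; exact junk_append_eq_zero hnm.ne' hF hG hH

/-- Translation invariance of `J'` (all degrees, all test functions). -/
theorem junk'_translate (n : ℕ) (a : E4) (F : SchwartzMap (Fin n → E4) ℂ) :
    junk' n (translateMulti a F) = junk' n F := by
  rcases Nat.eq_zero_or_pos n with rfl | hn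
  · rw [junk'_zero]; rfl
  · rw [junk'_of_ne_zero hn.ne']; exact junk_translate n a F

/-- Invariance of `J'` under every axis-permuting isometry. -/
theorem junk'_hyper (n : ℕ) {R : E4 ≃ₗᵢ[ℝ] E4} (hR : IsHyper R) (F : SchwartzMap (Fin n → E4) ℂ) :
    junk' n (linActMulti R F) = junk' n F := by
  rcases Nat.eq_zero_or_pos n with rfl | hn
  · rw [junk'_zero]; rfl
  · rw [junk'_of_ne_zero hn.ne']; exact junk_hyper n hR F

/-- Permutation symmetry of `J'`. -/
theorem junk'_permTest (n : ℕ) (π : Equiv.Perm (Fin n)) (F : SchwartzMap (Fin n → E4) ℂ) :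
    junk' n (permTest π F) = junk' n F := by
  rcases Nat.eq_zero_or_pos n with rfl | hn
  · rw [junk'_zero]; rfl
  · rw [junk'_of_ne_zero hn.ne']; exact junk_permTest n π F

/-- `‖J' F‖ ≤ ‖junk F‖` degreewise. -/
theorem norm_junk'_le (n : ℕ) (F : SchwartzMap (Fin n → E4) ℂ) : ‖junk' n F‖ ≤ ‖junk n F‖ := by
  rcases Nat.eq_zero_or_pos n with rfl | hn
  · rw [junk'_zero]; simp
  · rw [junk'_of_ne_zero hn.ne']

section Blind

variable {ι : Type}

/-- **The countermodel**: the one-field family `S` on every label string, plus the junk `J'`. -/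
def blind (S : SchwingerFamily E4) : LabelledSchwingerFamily ι E4 := fun n _ => S n + junk' n

variable {S : SchwingerFamily E4}

/-- Unfolding the countermodel. -/
@[simp] theorem blind_apply (n : ℕ) (k : Fin n → ι) (F : SchwartzMap (Fin n → E4) ℂ) :
    (blind S : LabelledSchwingerFamily ι E4) n k F = S n F + junk' n F := rfl

/-- E0 (normalisation). -/
theorem blind_isNormalized (h : S.toLabelled.IsNormalized) :
    (blind S : LabelledSchwingerFamily ι E4).IsNormalized := by
  intro k F
  rw [blind_apply, junk'_zero, _root_.zero_apply, add_zero]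
  exact h (fun _ => ()) F

/-- E0 (hermiticity). -/
theorem blind_isHermitian (h : S.toLabelled.IsHermitian) :
    (blind S : LabelledSchwingerFamily ι E4).IsHermitian := by
  intro n k F hF
  rw [blind_apply, blind_apply, junk'_timeSep (timeSep_of_isTimeOrdered hF),
    junk'_osAdjoint_timeSep (timeSep_of_isTimeOrdered hF), add_zero, add_zero]
  exact h n (fun _ => ()) F hF

/-- Monotone absorption of one linear-growth bound into a larger one. -/
theorem growth_aux {α β β' x N N' : ℝ} (hx : 1 ≤ x) (hβ : β ≤ β') (hN : N ≤ N') (hN0 : 0 ≤ N) :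
    α * x ^ β * N ≤ max α 0 * x ^ β' * N' := by
  have hxβ : 0 < x ^ β := Real.rpow_pos_of_pos (by linarith) β
  have hxβ' : x ^ β ≤ x ^ β' := Real.rpow_le_rpow_of_exponent_le hx hβ
  rcases le_or_gt α 0 with hα | hα
  · calc α * x ^ β * N ≤ 0 := mul_nonpos_of_nonpos_of_nonneg (mul_nonpos_of_nonpos_of_nonneg hα hxβ.le) hN0
      _ ≤ max α 0 * x ^ β' * N' := mul_nonneg (mul_nonneg (le_max_right _ _) (hxβ.le.trans hxβ')) (hN0.trans hN)
  · rw [max_eq_left hα.le]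
    exact mul_le_mul (mul_le_mul_of_nonneg_left hxβ' hα.le) hN hN0 (mul_nonneg hα.le (hxβ.le.trans hxβ'))

/-- E0' (linear growth): the sum of two families with linear growth has linear growth. -/
theorem blind_hasLinearGrowth (h : S.toLabelled.HasLinearGrowth) :
    (blind S : LabelledSchwingerFamily ι E4).HasLinearGrowth := by
  intro T
  obtain ⟨s₁, α₁, β₁, h₁⟩ := h Finset.univ
  obtain ⟨s₂, α₂, β₂, h₂⟩ := junk_hasLinearGrowth Finset.univ
  refine ⟨max s₁ s₂, max α₁ 0 + max α₂ 0, max β₁ β₂, fun n k _ F hF => ?_⟩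
  have e1 := h₁ n (fun _ => ()) (fun _ => Finset.mem_univ _) F hF
  have e2 := h₂ n (fun _ => ()) (fun _ => Finset.mem_univ _) F hF
  simp only [SchwingerFamily.toLabelled_apply] at e1 e2
  have hx : (1 : ℝ) ≤ (n.factorial : ℝ) := by exact_mod_cast Nat.one_le_iff_ne_zero.2 (Nat.factorial_ne_zero n)
  have b1 := (e1.trans (growth_aux hx (le_max_left β₁ β₂)
    (schwartzNorm_mono (Nat.mul_le_mul_left n (le_max_left s₁ s₂)) F) (schwartzNorm_nonneg _ _)))
  have b2 := ((norm_junk'_le n F).trans (e2.trans (growth_aux hx (le_max_right β₁ β₂)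
    (schwartzNorm_mono (Nat.mul_le_mul_left n (le_max_right s₁ s₂)) F) (schwartzNorm_nonneg _ _))))
  calc ‖(blind S : LabelledSchwingerFamily ι E4) n k F‖ = ‖S n F + junk' n F‖ := rfl
    _ ≤ ‖S n F‖ + ‖junk' n F‖ := norm_add_le _ _
    _ ≤ _ := by linarith

/-- E2 (reflection positivity): the OS form of `S + J'` IS the OS form of `S`. -/
theorem blind_rp (h : S.toLabelled.IsReflectionPositive) :
    (blind S : LabelledSchwingerFamily ι E4).IsReflectionPositive := by
  intro N deg lab F hF H hH
  have key : ∀ i j, (blind S : LabelledSchwingerFamily ι E4) (deg i + deg j)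
      (Fin.append (lab i ∘ Fin.rev) (lab j)) (H i j) = S (deg i + deg j) (H i j) := fun i j => by
    rw [blind_apply, junk'_append (timeSep_of_isTimeOrdered (hF i)) (timeSep_of_isTimeOrdered (hF j)) (hH i j),
      add_zero]
  have h' := h N deg (fun j _ => ()) F hF H hH
  simp only [SchwingerFamily.toLabelled_apply] at h'
  simp only [key]
  exact h'

/-- E3 (symmetry). -/
theorem blind_isSymmetric (h : S.toLabelled.IsSymmetric) :
    (blind S : LabelledSchwingerFamily ι E4).IsSymmetric := by
  intro n k π F hF
  have h' := h n (fun _ => ()) π F hF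
  simp only [SchwingerFamily.toLabelled_apply] at h'
  rw [blind_apply, blind_apply, h', junk'_permTest]

/-- The clustered quantities of `S + J'` are those of `S`. -/
theorem blind_truncated {n m : ℕ} {F : SchwartzMap (Fin n → E4) ℂ} {G : SchwartzMap (Fin m → E4) ℂ}
    (hF : IsTimeOrdered F) (hG : IsTimeOrdered G) (a : E4) (ha : 0 ≤ a 0)
    {H : SchwartzMap (Fin (n + m) → E4) ℂ} (hH : IsAppendTensorOf H (osAdjoint F) (translateMulti a G))
    (k : Fin (n + m) → ι) (k₁ : Fin n → ι) (k₂ : Fin m → ι) :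
    (blind S : LabelledSchwingerFamily ι E4) (n + m) k H -
        (blind S : LabelledSchwingerFamily ι E4) n k₁ (osAdjoint F) * (blind S : LabelledSchwingerFamily ι E4) m k₂ G =
      S (n + m) H - S n (osAdjoint F) * S m G := by
  have hG' : TimeSep (translateMulti a G) := (timeSep_of_isTimeOrdered hG).translate a ha
  rw [blind_apply, blind_apply, blind_apply, junk'_append (timeSep_of_isTimeOrdered hF) hG' hH,
    junk'_osAdjoint_timeSep (timeSep_of_isTimeOrdered hF), junk'_timeSep (timeSep_of_isTimeOrdered hG)]
  ring

/-- E4 (cluster property). -/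
theorem blind_cluster (h : S.toLabelled.HasClusterProperty) :
    (blind S : LabelledSchwingerFamily ι E4).HasClusterProperty := by
  intro n m k k' F G hF hG a ha0 ha H hH
  have h' := h n m (fun _ => ()) (fun _ => ()) F G hF hG a ha0 ha H hH
  simp only [SchwingerFamily.toLabelled_apply] at h'
  refine h'.congr' (Eventually.of_forall fun t => ?_)
  exact (blind_truncated hF hG (t • a) (by simp [ha0]) (hH t) _ _ _).symm

/-- Translation invariance on `⁰𝒮`. -/
theorem blind_translate (h : ∀ (n : ℕ) (a : E4) (F : 𝓢((Fin n → E4), ℂ)), IsOffDiagonal F →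
      S n (translateMulti a F) = S n F) (n : ℕ) (k : Fin n → ι) (a : E4) (F : 𝓢((Fin n → E4), ℂ))
    (hF : IsOffDiagonal F) :
    (blind S : LabelledSchwingerFamily ι E4) n k (translateMulti a F) = (blind S : LabelledSchwingerFamily ι E4) n k F := by
  rw [blind_apply, blind_apply, h n a F hF, junk'_translate]

/-- Invariance on `⁰𝒮` under axis-permuting isometries (from full isometry invariance of `S`). -/
theorem blind_hyper (h : ∀ (R : E4 ≃ₗᵢ[ℝ] E4) (n : ℕ) (F : 𝓢((Fin n → E4), ℂ)), IsOffDiagonal F →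
      S n (linActMulti R F) = S n F) (n : ℕ) (k : Fin n → ι) {R : E4 ≃ₗᵢ[ℝ] E4} (hR : IsHyper R)
    (F : 𝓢((Fin n → E4), ℂ)) (hF : IsOffDiagonal F) :
    (blind S : LabelledSchwingerFamily ι E4) n k (linActMulti R F) = (blind S : LabelledSchwingerFamily ι E4) n k F := by
  rw [blind_apply, blind_apply, h R n F hF, junk'_hyper n hR]

/-- The continuum mass gap. -/
theorem blind_hasMassGap {Δ : ℝ} (h : S.toLabelled.HasMassGap Δ) :
    (blind S : LabelledSchwingerFamily ι E4).HasMassGap Δ := by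
  intro n m k k' F G hF hG
  obtain ⟨C, hC⟩ := h n m (fun _ => ()) (fun _ => ()) F G hF hG
  refine ⟨C, fun t ht H hH => ?_⟩
  rw [blind_truncated hF hG _ (by simpa using ht) hH]
  simpa using hC t ht H hH

/-- Non-triviality of the truncated two-point function transfers (the junk has no degree `1, 2`). -/
theorem blind_nontrivial (s : ι)
    (h : ∃ (F₁ G₁ : 𝓢((Fin 1 → E4), ℂ)) (H₁ : 𝓢((Fin (1 + 1) → E4), ℂ)),
      IsTimeOrdered F₁ ∧ IsTimeOrdered G₁ ∧ IsAppendTensorOf H₁ (osAdjoint F₁) G₁ ∧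
        S (1 + 1) H₁ ≠ S 1 (osAdjoint F₁) * S 1 G₁) :
    CurvNontrivial (blind S : LabelledSchwingerFamily ι E4) s := by
  obtain ⟨F₁, G₁, H₁, hF, hG, hH, hne⟩ := h
  refine ⟨F₁, G₁, H₁, hF, hG, hH, ?_⟩
  have hH' : IsAppendTensorOf H₁ (osAdjoint F₁) (translateMulti (0 : E4) G₁) := by
    have : translateMulti (0 : E4) G₁ = G₁ := by ext x; simp [translateMulti_apply]
    rwa [this]
  have key := blind_truncated (S := S) hF hG (0 : E4) le_rfl hH' (fun _ => s) (fun _ => s) (fun _ => s)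
  intro heq
  apply hne
  rw [← sub_eq_zero, ← key, heq, sub_self]

/-- **The conclusion fails for `S + J'`** whenever `S` is invariant on `⁰𝒮` under the Σ5 rotation:
`J (R · F₀) = 0 ≠ J F₀`. -/
theorem not_sigmaFive_blind (s : ι)
    (h : ∀ (R : E4 ≃ₗᵢ[ℝ] E4) (n : ℕ) (F : 𝓢((Fin n → E4), ℂ)), IsOffDiagonal F → S n (linActMulti R F) = S n F) :
    ¬ SigmaFive (blind S : LabelledSchwingerFamily ι E4) s := by
  intro hS5
  have h4 := hS5 Rσ Rσ_isSigmaFive 4 F₀ F₀_isOffDiagonal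
  simp only [blind_apply] at h4
  have e1 : S 4 (linActMulti Rσ F₀) = S 4 F₀ := h Rσ 4 F₀ F₀_isOffDiagonal
  have e2 : junk' 4 (linActMulti Rσ F₀) = 0 := by
    have hj : junk' 4 = J := junk'_four
    rw [hj]; exact J_RσF₀
  have e3 : junk' 4 F₀ = J F₀ := by
    have hj : junk' 4 = J := junk'_four
    rw [hj]
  have h0 : J F₀ = 0 := by linear_combination e1 + e2 - e3 - h4
  have hpos := J_F₀_re_pos
  rw [h0, Complex.zero_re] at hpos
  exact lt_irrefl _ hpos

end Blind

/-! ## §5 The model-blind form is false modulo `H` -/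

/-- The weak-coupling scheme `β_k = k` (spacings and volumes of the zero scheme, `c = m = 0`). -/
def weakScheme (ι : Type) : SpeciesScheme ι := { SpeciesScheme.zero ι with β := fun k => k }

/-- `β_k = k → ∞`: the scheme is at weak coupling. -/
theorem weakScheme_hasWeakCouplingLimit (ι : Type) : (weakScheme ι).HasWeakCouplingLimit :=
  tendsto_natCast_atTop_atTop

/-- **Theorem (the Wilson tie is load-bearing; negative lemma modulo `H`, clauses explicit).** Given ONE
one-field family `S` on `ℝ⁴` with E0 (both parts), E0', E2, E3, E4, translation and full isometry invariance on `⁰𝒮`,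
a mass gap `Δ > 0` and a non-trivial truncated two-point function at a reflected pair (e.g. the free massive field —
the clauses of the Literature named fact `IsotropicOSFamilyExists`), the model-blind form of `CurvatureAmnesia` is
false: `G = SU(2)`, the fundamental representation, the weak-coupling scheme `β_k = k`, and the family `S + J'`.
[folklore] -/
theorem curvatureAmnesiaModelBlind_false_of (S : SchwingerFamily E4)
    (hN : S.toLabelled.IsNormalized) (hHerm : S.toLabelled.IsHermitian) (hLG : S.toLabelled.HasLinearGrowth)
    (hRP : S.toLabelled.IsReflectionPositive) (hSym : S.toLabelled.IsSymmetric)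
    (hCl : S.toLabelled.HasClusterProperty)
    (hTr : ∀ (n : ℕ) (a : E4) (F : 𝓢((Fin n → E4), ℂ)), IsOffDiagonal F → S n (translateMulti a F) = S n F)
    (hIso : ∀ (R : E4 ≃ₗᵢ[ℝ] E4) (n : ℕ) (F : 𝓢((Fin n → E4), ℂ)), IsOffDiagonal F → S n (linActMulti R F) = S n F)
    {Δ : ℝ} (hΔ : 0 < Δ) (hGap : S.toLabelled.HasMassGap Δ)
    (hNT : ∃ (F₁ G₁ : 𝓢((Fin 1 → E4), ℂ)) (H₁ : 𝓢((Fin (1 + 1) → E4), ℂ)),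
      IsTimeOrdered F₁ ∧ IsTimeOrdered G₁ ∧ IsAppendTensorOf H₁ (osAdjoint F₁) G₁ ∧
        S (1 + 1) H₁ ≠ S 1 (osAdjoint F₁) * S 1 G₁) :
    ¬ CurvatureAmnesiaModelBlind := by
  intro h
  have hG : IsCompactSimpleLieGroup (Matrix.specialUnitaryGroup (Fin 2) ℂ) :=
    isCompactSimpleLieGroup_specialUnitaryGroup isSimpleCompactGroup_specialUnitaryGroup_holds le_rfl
  letI : MeasurableSpace (Matrix.specialUnitaryGroup (Fin 2) ℂ) := borel _
  haveI : BorelSpace (Matrix.specialUnitaryGroup (Fin 2) ℂ) := ⟨rfl⟩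
  let r : LatticeRep (Matrix.specialUnitaryGroup (Fin 2) ℂ) :=
    ⟨2, fundamentalRep (Fin 2), continuous_fundamentalRep _, fundamentalRep_injective _,
      fundamentalRep_mem_unitaryGroup⟩
  have hOS : OSBlock (blind S : LabelledSchwingerFamily (YMSpecies (Matrix.specialUnitaryGroup (Fin 2) ℂ)) E4) :=
    ⟨blind_isNormalized hN, blind_isHermitian hHerm, blind_hasLinearGrowth hLG, blind_rp hRP,
      blind_isSymmetric hSym, blind_cluster hCl, fun n k a F hF => blind_translate hTr n k a F hF,
      fun n k R _ hR F hF => blind_hyper hIso n k hR F hF⟩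
  exact not_sigmaFive_blind r.curvature hIso
    (h _ hG r (weakScheme _) (blind S) (weakScheme_hasWeakCouplingLimit _) hOS (blind_nontrivial _ hNT)
      ⟨Δ, hΔ, blind_hasMassGap hGap⟩)

/-- **The same, bundled**: the hypothesis is character-identical to the body of the Literature named fact
`Literature.MathematicalPhysics.QuantumFieldTheory.IsotropicOSFamilyExists` (one non-trivial, massive, Euclidean-invariant
one-field OS family on `ℝ⁴` — the free massive field), so that `curvatureAmnesiaModelBlind_false_of_exists h` typechecks
for `h : IsotropicOSFamilyExists` by unfolding. [folklore] -/
theorem curvatureAmnesiaModelBlind_false_of_exists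
    (h : ∃ S : SchwingerFamily (EuclideanSpace ℝ (Fin 4)),
      S.toLabelled.IsNormalized ∧ S.toLabelled.IsHermitian ∧ S.toLabelled.HasLinearGrowth ∧
      S.toLabelled.IsReflectionPositive ∧ S.toLabelled.IsSymmetric ∧ S.toLabelled.HasClusterProperty ∧
      (∀ (n : ℕ) (a : EuclideanSpace ℝ (Fin 4)) (F : 𝓢((Fin n → EuclideanSpace ℝ (Fin 4)), ℂ)),
        IsOffDiagonal F → S n (translateMulti a F) = S n F) ∧
      (∀ (R : EuclideanSpace ℝ (Fin 4) ≃ₗᵢ[ℝ] EuclideanSpace ℝ (Fin 4)) (n : ℕ)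
        (F : 𝓢((Fin n → EuclideanSpace ℝ (Fin 4)), ℂ)), IsOffDiagonal F → S n (linActMulti R F) = S n F) ∧
      (∃ Δ : ℝ, 0 < Δ ∧ S.toLabelled.HasMassGap Δ) ∧
      ∃ (F₁ G₁ : 𝓢((Fin 1 → EuclideanSpace ℝ (Fin 4)), ℂ)) (H₁ : 𝓢((Fin (1 + 1) → EuclideanSpace ℝ (Fin 4)), ℂ)),
        IsTimeOrdered F₁ ∧ IsTimeOrdered G₁ ∧ IsAppendTensorOf H₁ (osAdjoint F₁) G₁ ∧
          S (1 + 1) H₁ ≠ S 1 (osAdjoint F₁) * S 1 G₁) :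
    ¬ CurvatureAmnesiaModelBlind := by
  obtain ⟨S, hN, hHerm, hLG, hRP, hSym, hCl, hTr, hIso, ⟨Δ, hΔ, hGap⟩, hNT⟩ := h
  exact curvatureAmnesiaModelBlind_false_of S hN hHerm hLG hRP hSym hCl hTr hIso hΔ hGap hNT

end Summit.QuantumFields.YangMills.Theorems.CurvatureAmnesia.Negative

end
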